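import Summits.ResolutionOfSingularities.ResolutionOfSingularities.Theorems.MarkedTransferCampaignW46WWalkModel
import Mathlib.RingTheory.MvPowerSeries.Expand
import Mathlib.Algebra.CharP.Algebra
import HarnessLib

/-!
# [OURS · L1 W4.6 rung (iii-2)] THE W-WALK: COMPARISON LEMMAS in `K⟦t, y, z⟧` — residual order versus the order of the inherited
# residual, and the cleaning dichotomy at a child (characteristic `p`)

Cell `res-hironaka`, LADDER-RESOLUTION rung L (D-0089), slot W4.6 rung (iii); seat res-L1-s46-pv-5 (gen 6), plan
`HOME/L/res-L1-s46-pv-5/W-WALK-PLAN.md` §1 (LEMMA C). Host route MarkedTransfer, `--supports stmt-ResolutionOfSingularities-16155 --as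
helper`; kind proof (no definition).

WHAT (all in `K⟦t,y,z⟧ = MvPowerSeries (Option (Fin 2)) K`, `K` a field of characteristic `p`; `z = X none`).
* `coeff_pow_p` — in characteristic `p`, `[X^e] (w^p) = ([X^{e/p}] w)^p` if `p ∣ e` (all letters) and `0` otherwise (Mathlib
  `MvPowerSeries.map_frobenius_expand`).
* **LEMMA C** `coeff_eq_zero_of_mem_span_pow_sup` — if `z^p + f = c·w^p + h` with `w(0) = 0`, `ord f ≥ p + 1`, `ord h ≥ n + 1`,
  `p + 1 ≤ n ≤ 2p − 1`, then EVERY degree-`n` monomial of `f` with `z`-exponent `< p` has coefficient `0`. So: if the inherited residual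
  `f` (of order `d`, all of whose degree-`d` monomials have `z`-exponent `< p` — automatic when the shade is `< p`) then `z^p + f ∉ (w^p) +
  𝔪^{d+1}` for every `w ∈ 𝔪`: o1's `residualOrder` of the germ is EXACTLY `d` (no presentation does better), the input of (ND).
* **LEMMA C′** `coeff_eq_zero_of_mem_span_pow_sup_self` / `exists_pow_eq_coeff_of_mem_span_pow_sup` — the CLEANING DICHOTOMY at a
  child: if `z^p + f ∈ (w^p) + 𝔪^{p+1}` (residual order `≥ p + 1`, i.e. the child is in the window) and the degree-`p` part of `f` has no
  `z^p`, then the only degree-`p` monomials of `f` are `t^p` and `y^p`, with coefficients that are `p`-th powers (so the cleaning shear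
  `z ↦ z − βt − γy` removes them).
Mechanism: `w = αz + βt + γy + (order ≥ 2)`, `w^p = α^p z^p + β^p t^p + γ^p y^p + (order ≥ 2p)` in characteristic `p`; comparing the
coefficients of `z^p`, `t^p`, `y^p` gives `c(0)α^p = 1` (resp. `β = γ = 0` when `ord f ≥ p+1`), and a degree-`n < 2p` monomial of `c·w^p`
with `z`-exponent `< p` can only come from `c · β^p t^p` or `c · γ^p y^p`.

HONEST FRAMING. OURS; nothing here is a statement of H. Hironaka's manuscript [Hironaka2017] and nothing of it is used. AI-written;
AI review is weaker than expert review. No `sorry`; axioms standard. [folklore] (p-th powers in characteristic p; Hauser 2010 §F for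
the role of the residual order). [Hauser2010]
-/

noncomputable section

set_option linter.dupNamespace false -- mandated namespace of this single-conjunct summit

open MvPowerSeries Finset

namespace Summit.ResolutionOfSingularities.ResolutionOfSingularities.Theorems

namespace CampaignW46

namespace WWalk

variable {K : Type*} [Field K] {p : ℕ} [Fact p.Prime] [CharP K p]

/-! ## §1 `p`-th powers of power series in characteristic `p` -/

/-- In characteristic `p`: `[X^{p•m}] (w^p) = ([X^m] w)^p`. [folklore] -/
theorem coeff_pow_p_smul (w : MvPowerSeries (Option (Fin 2)) K) (m : Option (Fin 2) →₀ ℕ) :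
    coeff (p • m) (w ^ p) = (coeff m w) ^ p := by
  have hp : p ≠ 0 := (Fact.out : p.Prime).ne_zero
  rw [← map_frobenius_expand p hp (f := w), coeff_map, coeff_expand_smul, frobenius_def]

/-- In characteristic `p`: `[X^e] (w^p) = 0` unless `p` divides every exponent of `e`. [folklore] -/
theorem coeff_pow_p_eq_zero_of_not_dvd (w : MvPowerSeries (Option (Fin 2)) K) {e : Option (Fin 2) →₀ ℕ} {i : Option (Fin 2)}
    (h : ¬ p ∣ e i) : coeff e (w ^ p) = 0 := by
  have hp : p ≠ 0 := (Fact.out : p.Prime).ne_zero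
  rw [← map_frobenius_expand p hp (f := w), coeff_map, coeff_expand_of_not_dvd p hp w h, map_zero]

/-- **`w^p` to precision `2p`**: for `w(0) = 0`, `w^p = β^p t^p + γ^p y^p + α^p z^p + R` with `ord R ≥ 2p`, where `β, γ, α` are the
linear coefficients of `w` (characteristic `p`: `(L + w₂)^p = L^p + w₂^p`). [folklore] -/
theorem pow_p_eq_linear_add (w : MvPowerSeries (Option (Fin 2)) K) (hw : constantCoeff w = 0) :
    ∃ R : MvPowerSeries (Option (Fin 2)) K, ((2 * p : ℕ) : ℕ∞) ≤ R.order ∧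
      w ^ p = C ((coeff (mk3 1 0 0) w) ^ p) * X (some 0) ^ p + C ((coeff (mk3 0 1 0) w) ^ p) * X (some 1) ^ p +
        C ((coeff (mk3 0 0 1) w) ^ p) * X none ^ p + R := by
  classical
  have hp : p ≠ 0 := (Fact.out : p.Prime).ne_zero
  set L : MvPowerSeries (Option (Fin 2)) K := C (coeff (mk3 1 0 0) w) * X (some 0) + C (coeff (mk3 0 1 0) w) * X (some 1) +
    C (coeff (mk3 0 0 1) w) * X none with hL
  set w₂ := w - L with hw₂
  -- `w₂` has no monomials of degree `≤ 1`
  have hw₂ord : (2 : ℕ∞) ≤ w₂.order := by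
    refine MvPowerSeries.le_order (fun e he => ?_)
    have he' : e.degree < 2 := by exact_mod_cast he
    rw [hw₂, map_sub, hL, map_add, map_add]
    simp only [coeff_C_mul, coeff_X]
    rcases Nat.lt_or_ge (e.degree) 1 with h0 | h1
    · -- degree 0: `e = 0`
      have he0 : e = 0 := (Finsupp.degree_eq_zero_iff e).mp (by omega)
      subst he0
      have h1 : ¬ ((0 : Option (Fin 2) →₀ ℕ) = Finsupp.single (some 0) 1) := fun h => by
        have := congrArg (fun e => e (some 0)) h; simp at this
      have h2 : ¬ ((0 : Option (Fin 2) →₀ ℕ) = Finsupp.single (some 1) 1) := fun h => by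
        have := congrArg (fun e => e (some 1)) h; simp at this
      have h3 : ¬ ((0 : Option (Fin 2) →₀ ℕ) = Finsupp.single none 1) := fun h => by
        have := congrArg (fun e => e none) h; simp at this
      rw [if_neg h1, if_neg h2, if_neg h3, coeff_zero_eq_constantCoeff, hw]; ring
    · -- degree 1: `e` is a single
      have hdeg1 : e.degree = 1 := by omega
      rw [degree_eq] at hdeg1
      have hcases : e = mk3 1 0 0 ∨ e = mk3 0 1 0 ∨ e = mk3 0 0 1 := by
        rw [← mk3_eta e, mk3_inj, mk3_inj, mk3_inj]; omega
      have hs0 : Finsupp.single (some 0) 1 = mk3 1 0 0 := by simp [mk3]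
      have hs1 : Finsupp.single (some 1) 1 = mk3 0 1 0 := by simp [mk3]
      have hsn : Finsupp.single none 1 = mk3 0 0 1 := by simp [mk3]
      rw [hs0, hs1, hsn]
      rcases hcases with h | h | h <;> rw [h] <;> simp [mk3_inj]
  refine ⟨w₂ ^ p, ?_, ?_⟩
  · have := le_order_pow_of_constantCoeff_eq_zero (f := w₂) p (by
      have h := coeff_of_lt_order (f := w₂) (d := 0) (by rw [map_zero]; exact lt_of_lt_of_le (by norm_num) hw₂ord)
      rwa [coeff_zero_eq_constantCoeff] at h)
    -- `ord (w₂^p) ≥ p · ord w₂ ≥ 2p`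
    have h2 := le_order_pow (f := w₂) p
    calc ((2 * p : ℕ) : ℕ∞) = p • (2 : ℕ∞) := by rw [nsmul_eq_mul]; push_cast; ring
      _ ≤ p • w₂.order := nsmul_le_nsmul_right hw₂ord p
      _ ≤ (w₂ ^ p).order := h2
  · have hw' : w = L + w₂ := by rw [hw₂]; ring
    haveI : CharP (MvPowerSeries (Option (Fin 2)) K) p := charP_of_injective_ringHom (MvPowerSeries.C_injective) p
    nth_rw 1 [hw']
    rw [add_pow_char, hL, add_pow_char, add_pow_char, mul_pow, mul_pow, mul_pow]
    simp only [map_pow]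

omit [Fact p.Prime] [CharP K p] in
/-- Coefficients of `c · (s·X_i^p)`: a shift by `p` in the letter `i`. [folklore] -/
theorem coeff_mul_C_mul_X_pow (c : MvPowerSeries (Option (Fin 2)) K) (s : K) (i : Option (Fin 2)) (e : Option (Fin 2) →₀ ℕ) :
    coeff e (c * (C s * X i ^ p)) = if p ≤ e i then coeff (e - Finsupp.single i p) c * s else 0 := by
  classical
  have hmon : C s * X i ^ p = monomial (Finsupp.single i p) s := by
    rw [X_pow_eq, ← monomial_zero_eq_C_apply, monomial_mul_monomial, zero_add, mul_one]
  rw [hmon, coeff_mul_monomial]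
  have : Finsupp.single i p ≤ e ↔ p ≤ e i := by
    rw [Finsupp.single_le_iff]
  simp only [this]

/-- **The coefficient of `t^a y^b z^c` in `c · w^p` for `a + b + c < 2p`, `w(0) = 0`**: only `c·β^p t^p`, `c·γ^p y^p`, `c·α^p z^p`
contribute (`β, γ, α` the linear coefficients of `w`). [folklore] -/
theorem coeff_mul_pow_p (c w : MvPowerSeries (Option (Fin 2)) K) (hw : constantCoeff w = 0) (a b cz : ℕ)
    (hdeg : a + b + cz < 2 * p) :
    coeff (mk3 a b cz) (c * w ^ p) =
      (if p ≤ a then coeff (mk3 (a - p) b cz) c * (coeff (mk3 1 0 0) w) ^ p else 0) +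
      (if p ≤ b then coeff (mk3 a (b - p) cz) c * (coeff (mk3 0 1 0) w) ^ p else 0) +
      (if p ≤ cz then coeff (mk3 a b (cz - p)) c * (coeff (mk3 0 0 1) w) ^ p else 0) := by
  classical
  obtain ⟨R, hR, hwp⟩ := pow_p_eq_linear_add w hw
  rw [hwp, mul_add, mul_add, mul_add, map_add, map_add, map_add]
  have hR0 : coeff (mk3 a b cz) (c * R) = 0 := by
    apply coeff_of_lt_order
    have h1 : ((mk3 a b cz).degree : ℕ∞) < ((2 * p : ℕ) : ℕ∞) := by rw [degree_mk3]; exact_mod_cast hdeg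
    exact lt_of_lt_of_le h1 ((hR.trans le_add_self).trans le_order_mul)
  rw [hR0, add_zero, coeff_mul_C_mul_X_pow, coeff_mul_C_mul_X_pow, coeff_mul_C_mul_X_pow]
  simp only [mk3_t, mk3_y, mk3_z]
  have e1 : mk3 a b cz - Finsupp.single (some 0) p = mk3 (a - p) b cz := by
    ext o; rcases o with _ | ⟨i, hi⟩
    · simp [mk3]
    · interval_cases i <;> simp [mk3]
  have e2 : mk3 a b cz - Finsupp.single (some 1) p = mk3 a (b - p) cz := by
    ext o; rcases o with _ | ⟨i, hi⟩
    · simp [mk3]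
    · interval_cases i <;> simp [mk3]
  have e3 : mk3 a b cz - Finsupp.single none p = mk3 a b (cz - p) := by
    ext o; rcases o with _ | ⟨i, hi⟩
    · simp [mk3]
    · interval_cases i <;> simp [mk3]
  rw [e1, e2, e3]

/-! ## §2 LEMMA C: no presentation beats the inherited residual (when its top form has `z`-degree `< p`) -/

/-- **LEMMA C.** In characteristic `p`, let `z^p + f = c · w^p + h` in `K⟦t,y,z⟧` with `w(0) = 0`, `ord f ≥ p + 1`, `ord h ≥ n + 1`,
`p + 1 ≤ n ≤ 2p − 1`. Then every monomial `t^a y^b z^{c}` of degree `n` with `c < p` has coefficient `0` in `f`. (Comparing `z^p`,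
`t^p`, `y^p`: `c(0)α^p = 1`, `β = γ = 0`; then no degree-`n` monomial with `z`-exponent `< p` receives anything from `c·w^p`.)
Contrapositive = the residual order of the germ `(z^p + f)` is EXACTLY `ord f` whenever the degree-`(ord f)` form of `f` has a monomial
of `z`-degree `< p`. [cite: Hauser2010, §F (residual order of purely inseparable equations; here for arbitrary residuals)] -/
theorem coeff_eq_zero_of_presentation {f c w h : MvPowerSeries (Option (Fin 2)) K} (hw : constantCoeff w = 0) {n : ℕ}
    (hpn : p + 1 ≤ n) (hn2 : n + 1 ≤ 2 * p) (hf : LowVanish (p + 1) f) (hh : LowVanish (n + 1) h)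
    (hg : X none ^ p + f = c * w ^ p + h) {a b cz : ℕ} (habc : a + b + cz = n) (hcz : cz < p) :
    coeff (mk3 a b cz) f = 0 := by
  classical
  have hp1 : 2 ≤ p := (Fact.out : p.Prime).two_le
  -- coefficient identities from `hg`
  have hco : ∀ e, coeff e (X none ^ p : MvPowerSeries (Option (Fin 2)) K) + coeff e f = coeff e (c * w ^ p) + coeff e h := by
    intro e; have := congrArg (coeff e) hg; simpa only [map_add] using this
  have hXp : ∀ a b cz, coeff (mk3 a b cz) (X none ^ p : MvPowerSeries (Option (Fin 2)) K) =
      if a = 0 ∧ b = 0 ∧ cz = p then 1 else 0 := by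
    intro a b cz
    rw [X_pow_eq, coeff_monomial]
    have : mk3 a b cz = Finsupp.single none p ↔ (a = 0 ∧ b = 0 ∧ cz = p) := by
      rw [show Finsupp.single none p = mk3 0 0 p by simp [mk3], mk3_inj]
    by_cases h : a = 0 ∧ b = 0 ∧ cz = p
    · rw [if_pos (this.mpr h), if_pos h]
    · rw [if_neg (fun h' => h (this.mp h')), if_neg h]
  -- (1) `z^p`: `c(0) α^p = 1`
  have h1 := hco (mk3 0 0 p)
  rw [hXp, if_pos ⟨rfl, rfl, rfl⟩, hf _ (by rw [degree_mk3]; omega), hh _ (by rw [degree_mk3]; omega),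
    coeff_mul_pow_p c w hw 0 0 p (by omega)] at h1
  simp only [Nat.sub_self, show ¬ p ≤ 0 by omega, if_false, zero_add, le_refl, if_true, add_zero] at h1
  -- (2) `t^p`: `c(0) β^p = 0`, hence `β = 0`
  have h2 := hco (mk3 p 0 0)
  rw [hXp, if_neg (by omega), hf _ (by rw [degree_mk3]; omega), hh _ (by rw [degree_mk3]; omega),
    coeff_mul_pow_p c w hw p 0 0 (by omega)] at h2
  simp only [Nat.sub_self, show ¬ p ≤ 0 by omega, if_false, add_zero, le_refl, if_true] at h2
  -- (3) `y^p`: `γ = 0`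
  have h3 := hco (mk3 0 p 0)
  rw [hXp, if_neg (by omega), hf _ (by rw [degree_mk3]; omega), hh _ (by rw [degree_mk3]; omega),
    coeff_mul_pow_p c w hw 0 p 0 (by omega)] at h3
  simp only [Nat.sub_self, show ¬ p ≤ 0 by omega, if_false, add_zero, le_refl, if_true, zero_add] at h3
  have hc0 : coeff (mk3 0 0 0) c ≠ 0 := by
    intro h0; rw [h0, zero_mul] at h1; exact one_ne_zero h1
  have hβ : coeff (mk3 1 0 0) w ^ p = 0 := by
    rcases mul_eq_zero.mp h2.symm with h | h
    · exact absurd h hc0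
    · exact h
  have hγ : coeff (mk3 0 1 0) w ^ p = 0 := by
    rcases mul_eq_zero.mp h3.symm with h | h
    · exact absurd h hc0
    · exact h
  -- (4) the monomial `t^a y^b z^cz`
  have h4 := hco (mk3 a b cz)
  rw [hXp, if_neg (by omega), hh _ (by rw [degree_mk3]; omega), coeff_mul_pow_p c w hw a b cz (by omega), hβ, hγ,
    zero_add, add_zero] at h4
  simp only [mul_zero, ite_self, zero_add, show ¬ p ≤ cz by omega, if_false] at h4
  exact h4

/-! ## §3 LEMMA C′: the cleaning dichotomy at a child of residual order `≥ p + 1` -/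

/-- **LEMMA C′.** In characteristic `p`, let `z^p + f = c · w^p + h` in `K⟦t,y,z⟧` with `w(0) = 0`, `ord f ≥ p`, `ord h ≥ p + 1`, and
suppose the coefficient of `z^p` in `f` is `0`. Then every degree-`p` monomial of `f` other than `t^p`, `y^p` has coefficient `0`, and the
coefficients of `t^p` and `y^p` are `p`-th powers (`(β/α)^p`, `(γ/α)^p`). So a residual of order `p` whose degree-`p` form avoids `z^p`
and `y^p` (as the inherited residual of a child in the window does) is `β′^p t^p + (order ≥ p+1)`: the cleaning shear `z ↦ z − β′t`
raises its order. [cite: Hauser2010, §G (cleaning)] -/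
theorem degree_p_coeff_of_presentation {f c w h : MvPowerSeries (Option (Fin 2)) K} (hw : constantCoeff w = 0)
    (hfz : coeff (mk3 0 0 p) f = 0) (hh : LowVanish (p + 1) h) (hg : X none ^ p + f = c * w ^ p + h) :
    (∀ a b cz, a + b + cz = p → a ≠ p → b ≠ p → coeff (mk3 a b cz) f = 0) ∧
      (∃ β' : K, coeff (mk3 p 0 0) f = β' ^ p) ∧ (∃ γ' : K, coeff (mk3 0 p 0) f = γ' ^ p) := by
  classical
  have hp1 : 2 ≤ p := (Fact.out : p.Prime).two_le
  have hco : ∀ e, coeff e (X none ^ p : MvPowerSeries (Option (Fin 2)) K) + coeff e f = coeff e (c * w ^ p) + coeff e h := by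
    intro e; have := congrArg (coeff e) hg; simpa only [map_add] using this
  have hXp : ∀ a b cz, coeff (mk3 a b cz) (X none ^ p : MvPowerSeries (Option (Fin 2)) K) =
      if a = 0 ∧ b = 0 ∧ cz = p then 1 else 0 := by
    intro a b cz
    rw [X_pow_eq, coeff_monomial]
    have : mk3 a b cz = Finsupp.single none p ↔ (a = 0 ∧ b = 0 ∧ cz = p) := by
      rw [show Finsupp.single none p = mk3 0 0 p by simp [mk3], mk3_inj]
    by_cases h : a = 0 ∧ b = 0 ∧ cz = p
    · rw [if_pos (this.mpr h), if_pos h]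
    · rw [if_neg (fun h' => h (this.mp h')), if_neg h]
  -- `z^p`: `c(0) α^p = 1`
  have h1 := hco (mk3 0 0 p)
  rw [hXp, if_pos ⟨rfl, rfl, rfl⟩, hfz, hh _ (by rw [degree_mk3]; omega), coeff_mul_pow_p c w hw 0 0 p (by omega)] at h1
  simp only [Nat.sub_self, show ¬ p ≤ 0 by omega, if_false, zero_add, le_refl, if_true, add_zero] at h1
  set c0 := coeff (mk3 0 0 0) c with hc0def
  set α := coeff (mk3 0 0 1) w with hα
  have hc0 : c0 ≠ 0 := by intro h0; rw [h0, zero_mul] at h1; exact one_ne_zero h1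
  have hα0 : α ≠ 0 := by intro h0; rw [h0, zero_pow (by omega), mul_zero] at h1; exact one_ne_zero h1
  have hc0eq : c0 = (α⁻¹) ^ p := by
    have : c0 * α ^ p * (α⁻¹) ^ p = (α⁻¹) ^ p := by rw [← h1, one_mul]
    rwa [mul_assoc, ← mul_pow, mul_inv_cancel₀ hα0, one_pow, mul_one] at this
  refine ⟨fun a b cz habc ha hb => ?_, ⟨α⁻¹ * coeff (mk3 1 0 0) w, ?_⟩, ⟨α⁻¹ * coeff (mk3 0 1 0) w, ?_⟩⟩
  · by_cases hcz : cz = p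
    · have : a = 0 ∧ b = 0 := by omega
      rw [this.1, this.2, hcz]; exact hfz
    · have h4 := hco (mk3 a b cz)
      rw [hXp, if_neg (by omega), hh _ (by rw [degree_mk3]; omega), coeff_mul_pow_p c w hw a b cz (by omega), zero_add,
        add_zero] at h4
      simp only [show ¬ p ≤ a by omega, show ¬ p ≤ b by omega, show ¬ p ≤ cz by omega, if_false, add_zero] at h4
      exact h4
  · have h2 := hco (mk3 p 0 0)
    rw [hXp, if_neg (by omega), hh _ (by rw [degree_mk3]; omega), coeff_mul_pow_p c w hw p 0 0 (by omega), zero_add,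
      add_zero] at h2
    simp only [Nat.sub_self, show ¬ p ≤ 0 by omega, if_false, add_zero, le_refl, if_true] at h2
    rw [h2, ← hc0def, hc0eq, mul_pow, ← mul_pow, mul_pow]
  · have h3 := hco (mk3 0 p 0)
    rw [hXp, if_neg (by omega), hh _ (by rw [degree_mk3]; omega), coeff_mul_pow_p c w hw 0 p 0 (by omega), zero_add,
      add_zero] at h3
    simp only [Nat.sub_self, show ¬ p ≤ 0 by omega, if_false, add_zero, zero_add, le_refl, if_true] at h3
    rw [h3, ← hc0def, hc0eq, mul_pow, ← mul_pow, mul_pow]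

end WWalk



end CampaignW46

end Summit.ResolutionOfSingularities.ResolutionOfSingularities.Theorems

end
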